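import Mathlib.Analysis.Convex.Contractible
import Mathlib.Analysis.Normed.Module.Connected
import Mathlib.Topology.Homeomorph.Lemmas
import Literature.AlgebraicTopology.SingularHomology.MayerVietorisExactness
import Literature.AlgebraicTopology.SingularHomology.CollapseMap
import Literature.AlgebraicTopology.SingularHomology.PuncturedEuclidean
import Literature.AlgebraicTopology.FundamentalGroupoid.SimplyConnectedComplPoint
import HarnessLib

/-!
# The link of a Euclidean point of a contractible space is a homology sphere

Topic `Literature/AlgebraicTopology/SingularHomology`. Let `X` be a contractible Hausdorff space
and `i : ℝᵐ⁺¹ → X` an open embedding (a "Euclidean neighbourhood" of the point `p = i 0`, e.g. a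
chart, or an open disc in the interior of a manifold with boundary), `m ≥ 1`. Then the embedded
unit sphere `y ↦ i y : Sᵐ → X ∖ {p}` induces isomorphisms on all singular homology groups
`Hₖ(-; M)` (`Literature.AlgebraicTopology.SingularHomology.isIso_singularHomology_map_sphereToComplCenter`).
This is the homological step of Kervaire–Milnor's proof of their Lemma 2.3 (*Groups of homotopy
spheres I*, Ann. of Math. 77 (1963), p. 506): for `W'` contractible and `W = W' - Int Dⁿ⁺¹`,
"Mapping the homology exact sequence of the pair `(Dⁿ⁺¹, Sⁿ)` into that of the pair `(W', W)`,
we see that the inclusion `Sⁿ → W` induces a homology isomorphism" — here with `W` replaced by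
the homotopy equivalent `W' ∖ {p}` (`ComplBallHomotopyEquiv.lean`), and proved with the
Mayer–Vietoris sequence of the open cover `X = (X ∖ {p}) ∪ i(ℝᵐ⁺¹)` (Hatcher, *Algebraic
Topology* (2002), §2.2, pp. 149–150) instead of the equivalent excision argument: the two pieces
`i(ℝᵐ⁺¹) ≅ ℝᵐ⁺¹` and `X` are contractible, so `Hₖ(i(ℝᵐ⁺¹) ∖ {p}) → Hₖ(X ∖ {p})` is an
isomorphism for `k ≥ 1`, and `i(ℝᵐ⁺¹) ∖ {p} ≅ ℝᵐ⁺¹ ∖ {0} ≃ Sᵐ`; in degree `0` both spaces are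
path connected (`m ≥ 1`; general position, tree theorem
`isPathConnected_compl_singleton_of_isOpenEmbedding`).

Everything is proved; the file adds no named fact. Contents:

* `mayerVietoris.isIso_map_inter_left_of_isZero` (general): for an open-interior cover
  `X = U ∪ V` with `Hₙ₊₁(X) = Hₙ(X) = 0` and `Hₙ(V) = 0`, the inclusion `U ∩ V ↪ U` is an
  isomorphism on `Hₙ` (Hatcher 2002, §2.2 p. 149; from the proved exactness
  `mayerVietoris.exact₁_holds`, `exact₃_holds` and excision `isIso_map_of_interior_union_interior_holds`).
* `sphereToComplCenter hi : C(Sᵐ, X ∖ {i 0})` and the main theorem. The point complement is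
  spelled `↥({i 0}ᶜ : Set X)` (as in `SimplyConnectedComplPoint.lean`); this is definitionally but
  not syntactically the `ComplCenterT i = {x // x ≠ i 0}` of `ComplBallHomotopyEquiv.lean`, so a
  consumer composing with `ComplBall.homotopyEquiv` bridges the two by the identity homeomorphism.
* `complZeroHomeomorphPunctured n : ℝⁿ ∖ {0} ≅ punctured n`, the upstream home of the identical
  `Literature.Topology.FourManifolds.complZeroHomeomorphPunctured` (which it supersedes).

Universe: the main theorem is stated for `X : Type` (the sphere `Sᵐ ⊆ EuclideanSpace ℝ (Fin (m+1))`
lives in `Type`, and `singularHomology.map` relates spaces of one universe), which is the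
generality used by its consumers (carriers of the tree's manifolds with boundary are in `Type`).

## References

* M. Kervaire, J. Milnor, *Groups of homotopy spheres I*, Ann. of Math. 77 (1963), proof of
  Lemma 2.3, p. 506. [KervaireMilnorAnnals1963]
* A. Hatcher, *Algebraic Topology*, CUP (2002), §2.2 pp. 149–150 (Mayer–Vietoris), Example 2.23
  / proof of Thm. 2.26 (`ℝⁿ - {0} ≃ Sⁿ⁻¹`), Prop. 2.7. [HatcherAT2002]
-/

noncomputable section

open CategoryTheory Limits Set Topology Metric

universe u v

namespace Literature.AlgebraicTopology.SingularHomology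

variable (R : Type v) [CommRing R] (M : Type v) [AddCommGroup M] [Module R M]

/-! ### A Mayer–Vietoris isomorphism criterion -/

section MayerVietoris

variable {X : Type u} [TopologicalSpace X]

/-- In a binary biproduct with zero second summand the first projection is an isomorphism
(the `fst` variant of Mathlib's `CategoryTheory.Biprod.isIso_inl_iff_isZero`, `Simple.lean`,
proved directly to avoid that import). [folklore] -/
theorem isIso_biprod_fst_of_isZero {C : Type*} [Category C] [Preadditive C] {A B : C}
    [HasBinaryBiproduct A B] (hB : IsZero B) : IsIso (biprod.fst : A ⊞ B ⟶ A) := by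
  refine ⟨⟨biprod.inl, ?_, biprod.inl_fst⟩⟩
  refine biprod.hom_ext _ _ ?_ ?_
  · rw [Category.assoc, biprod.inl_fst, Category.comp_id, Category.id_comp]
  · exact hB.eq_of_tgt _ _

/-- **Mayer–Vietoris isomorphism criterion.** Let `X = U ∪ V` with `interior U ∪ interior V = X`.
If `Hₙ₊₁(X; M) = 0`, `Hₙ(X; M) = 0` and `Hₙ(V; M) = 0`, then the inclusion `U ∩ V ↪ U` induces an
isomorphism `Hₙ(U ∩ V; M) ≅ Hₙ(U; M)`: in
`Hₙ₊₁(X) ⟶δ Hₙ(U ∩ V) ⟶φ Hₙ(U) ⊞ Hₙ(V) ⟶ψ Hₙ(X)` the outer terms vanish, so `φ = (i_{U*}, 0)` is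
an isomorphism (Hatcher, *Algebraic Topology* (2002), §2.2 p. 149). From the proved exactness of
the Mayer–Vietoris sequence (`mayerVietoris.exact₁_holds`, `exact₃_holds`) and proved excision
(`relativeSingularHomology.isIso_map_of_interior_union_interior_holds`). [cite: HatcherAT2002, §2.2 p. 149] -/
theorem mayerVietoris.isIso_map_inter_left_of_isZero (U V : Set X)
    (hUV : interior U ∪ interior V = univ) (n : ℕ)
    (hX₁ : IsZero (singularHomology R M X (n + 1))) (hX₀ : IsZero (singularHomology R M X n))
    (hV : IsZero (singularHomology R M V n)) :
    IsIso (singularHomology.map R M (subsetInclusion (inter_subset_left : U ∩ V ⊆ U)) n) := by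
  have hexc := relativeSingularHomology.isIso_map_of_interior_union_interior_holds R M X
  -- `φ` is a monomorphism: `δ = 0`
  have hδ : mayerVietoris.δ R M U V hexc hUV n = 0 := hX₁.eq_of_src _ _
  haveI hmono : Mono (mayerVietoris.φ R M U V n) :=
    (mayerVietoris.exact₃_holds R M U V hexc hUV n).mono_g hδ
  -- `φ` is an epimorphism: `ψ = 0`
  have hψ : mayerVietoris.ψ R M U V n = 0 := hX₀.eq_of_tgt _ _
  haveI hepi : Epi (mayerVietoris.φ R M U V n) :=
    (mayerVietoris.exact₁_holds R M U V hUV n).epi_f hψ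
  haveI : IsIso (mayerVietoris.φ R M U V n) := isIso_of_mono_of_epi _
  haveI := isIso_biprod_fst_of_isZero (A := singularHomology R M U n) hV
  have hfac : singularHomology.map R M (subsetInclusion (inter_subset_left : U ∩ V ⊆ U)) n =
      mayerVietoris.φ R M U V n ≫ biprod.fst := (biprod.lift_fst _ _).symm
  rw [hfac]
  infer_instance

end MayerVietoris

/-! ### The punctured Euclidean neighbourhood -/

section Euclidean

/-- `ℝⁿ ∖ {0}` (Euclidean model) is homeomorphic to the punctured coordinate space
`punctured n ⊆ (Fin n → ℝ)` of `PuncturedEuclidean.lean` (the coordinate isomorphism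
`EuclideanSpace.equiv`). This is the upstream home of the identical
`Literature.Topology.FourManifolds.complZeroHomeomorphPunctured`
(`Literature/Topology/FourManifolds/PuncturedHomotopySphereHomology.lean`), which it supersedes
(that copy is to become an alias in a later refactor). [folklore] -/
def complZeroHomeomorphPunctured (n : ℕ) :
    ↥(({0}ᶜ : Set (EuclideanSpace ℝ (Fin n)))) ≃ₜ ↥(punctured n) :=
  (coords n).toHomeomorph.subtype fun v => by
    simp only [mem_compl_iff, mem_singleton_iff, mem_punctured]
    exact (coords n).map_ne_zero_iff.symm

variable (m : ℕ)

/-- The inclusion of the unit sphere `Sᵐ` into `ℝᵐ⁺¹ ∖ {0}`. [folklore] -/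
def sphereToComplZero : C(↥(unitSphere (m + 1)), ↥(({0}ᶜ : Set (EuclideanSpace ℝ (Fin (m + 1)))))) where
  toFun y := ⟨y.1, ne_zero_of_mem_unitSphere _ y.2⟩
  continuous_toFun := continuous_subtype_val.subtype_mk _

/-- The inclusion `Sᵐ ↪ ℝᵐ⁺¹ ∖ {0}` is, up to the coordinate homeomorphism, the forward map of the
radial homotopy equivalence `sphereHomotopyEquivPunctured` (Hatcher 2002, proof of Thm. 2.26:
"`ℝⁿ - {0}` deformation retracts onto `Sⁿ⁻¹`"). [folklore] -/
theorem sphereToComplZero_eq :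
    sphereToComplZero m = ((complZeroHomeomorphPunctured (m + 1)).symm : C(_, _)).comp
      (sphereHomotopyEquivPunctured (m + 1)).toFun := by
  ext y : 1
  apply Subtype.ext
  change y.1 = (coords (m + 1)).symm (coords (m + 1) y.1)
  rw [ContinuousLinearEquiv.symm_apply_apply]

/-- The inclusion `Sᵐ ↪ ℝᵐ⁺¹ ∖ {0}` induces isomorphisms on all `Hₖ(-; M)` (it is a homotopy
equivalence; Hatcher 2002, proof of Thm. 2.26 and Cor. 2.11). [cite: HatcherAT2002, Cor. 2.11 and proof of Thm. 2.26] -/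
theorem isIso_singularHomology_map_sphereToComplZero (k : ℕ) :
    IsIso (singularHomology.map R M (sphereToComplZero m) k) := by
  rw [sphereToComplZero_eq, singularHomology.map_comp,
    ← singularHomology.isoOfHomotopyEquiv_hom, ← singularHomology.mapIso_hom]
  infer_instance

end Euclidean

/-! ### The link of a Euclidean point of a contractible space -/

section Link

variable {m : ℕ} {X : Type} [TopologicalSpace X] {i : EuclideanSpace ℝ (Fin (m + 1)) → X}

/-- **The embedded unit sphere around a Euclidean point**, as a map `Sᵐ → X ∖ {i 0}`, `y ↦ i y`
(for an injective continuous `i : ℝᵐ⁺¹ → X`; Kervaire–Milnor 1963, proof of Lemma 2.3: the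
inclusion `Sⁿ → W` of the boundary of the removed disc). [cite: KervaireMilnorAnnals1963, Lemma 2.3, proof (p. 506)] -/
def sphereToComplCenter (hi : IsEmbedding i) :
    C(↥(unitSphere (m + 1)), ↥(({i 0}ᶜ : Set X))) where
  toFun y := ⟨i y.1, fun h => ne_zero_of_mem_unitSphere _ y.2 (hi.injective h)⟩
  continuous_toFun := (hi.continuous.comp continuous_subtype_val).subtype_mk _

/-- The value of `sphereToComplCenter`. [folklore] -/
@[simp] theorem coe_sphereToComplCenter (hi : IsEmbedding i) (y : ↥(unitSphere (m + 1))) :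
    (sphereToComplCenter hi y : X) = i y := rfl

omit [TopologicalSpace X] in
/-- The intersection of the two pieces of the cover `X = (X ∖ {i 0}) ∪ i(ℝᵐ⁺¹)` is contained in
the range of `i`. [folklore] -/
theorem compl_inter_range_subset : ({i 0}ᶜ : Set X) ∩ range i ⊆ range i := inter_subset_right

omit [TopologicalSpace X] in
/-- The preimage under `i` of `(X ∖ {i 0}) ∩ i(ℝᵐ⁺¹)` is `ℝᵐ⁺¹ ∖ {0}` (for `i` injective).
[folklore] -/
theorem preimage_compl_inter_range (hi : Function.Injective i) :
    i ⁻¹' (({i 0}ᶜ : Set X) ∩ range i) = ({0}ᶜ : Set (EuclideanSpace ℝ (Fin (m + 1)))) := by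
  ext v
  simp only [mem_preimage, mem_inter_iff, mem_compl_iff, mem_singleton_iff, mem_range_self,
    and_true, hi.eq_iff]

/-- **The punctured neighbourhood**: `ℝᵐ⁺¹ ∖ {0} ≅ (X ∖ {i 0}) ∩ i(ℝᵐ⁺¹)` via `i`, for an
embedding `i`. [folklore] -/
def complZeroHomeomorphInter (hi : IsEmbedding i) :
    ↥(({0}ᶜ : Set (EuclideanSpace ℝ (Fin (m + 1))))) ≃ₜ ↥(({i 0}ᶜ : Set X) ∩ range i) :=
  (Homeomorph.setCongr (preimage_compl_inter_range hi.injective)).symm.trans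
    (hi.homeomorphOfSubsetRange compl_inter_range_subset)

/-- The value of `complZeroHomeomorphInter`. [folklore] -/
@[simp] theorem coe_complZeroHomeomorphInter (hi : IsEmbedding i)
    (v : ↥(({0}ᶜ : Set (EuclideanSpace ℝ (Fin (m + 1)))))) :
    (complZeroHomeomorphInter hi v : X) = i v := rfl

/-- The sphere map factors as `Sᵐ ↪ ℝᵐ⁺¹ ∖ {0} ≅ (X ∖ {i 0}) ∩ i(ℝᵐ⁺¹) ↪ X ∖ {i 0}`. [folklore] -/
theorem sphereToComplCenter_eq (hi : IsEmbedding i) :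
    sphereToComplCenter hi =
      (subsetInclusion (inter_subset_left : ({i 0}ᶜ : Set X) ∩ range i ⊆ {i 0}ᶜ)).comp
        (((complZeroHomeomorphInter hi) : C(_, _)).comp (sphereToComplZero m)) := by
  ext y : 1
  rfl

/-- The two pieces `X ∖ {i 0}` and `i(ℝᵐ⁺¹)` of an open embedding `i` form an open cover of `X`
(`X` a `T₁` space, so that points are closed). [folklore] -/
theorem interior_compl_union_interior_range [T1Space X] (hi : IsOpenEmbedding i) :
    interior ({i 0}ᶜ : Set X) ∪ interior (range i) = univ := by
  rw [isOpen_compl_singleton.interior_eq, hi.isOpen_range.interior_eq]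
  ext x
  simp only [mem_union, mem_compl_iff, mem_singleton_iff, mem_univ, iff_true]
  by_cases hx : x = i 0
  · exact Or.inr ⟨0, hx.symm⟩
  · exact Or.inl hx

/-- The range of an open embedding of `ℝᵐ⁺¹` is contractible, hence acyclic in positive degrees.
[folklore] -/
theorem isZero_singularHomology_range (hi : IsOpenEmbedding i) {k : ℕ} (hk : k ≠ 0) :
    IsZero (singularHomology R M ↥(range i) k) := by
  haveI : ContractibleSpace ↥(range i) :=
    hi.isEmbedding.toHomeomorph.contractibleSpace_iff.mp inferInstance
  exact isZero_singularHomology_of_contractibleSpace R M hk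

/-- **Positive degrees**: for `X` contractible and `i : ℝᵐ⁺¹ → X` an open embedding, the inclusion
`(X ∖ {i 0}) ∩ i(ℝᵐ⁺¹) ↪ X ∖ {i 0}` is an isomorphism on `Hₖ(-; M)` for every `k ≥ 1`
(Mayer–Vietoris for `X = (X ∖ {i 0}) ∪ i(ℝᵐ⁺¹)`: `Hₖ₊₁(X) = Hₖ(X) = Hₖ(i(ℝᵐ⁺¹)) = 0`;
Hatcher 2002, §2.2 p. 149). [cite: HatcherAT2002, §2.2 p. 149] -/
theorem isIso_singularHomology_map_inter_compl_center [T1Space X] [ContractibleSpace X]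
    (hi : IsOpenEmbedding i) {k : ℕ} (hk : k ≠ 0) :
    IsIso (singularHomology.map R M
      (subsetInclusion (inter_subset_left : ({i 0}ᶜ : Set X) ∩ range i ⊆ {i 0}ᶜ)) k) :=
  mayerVietoris.isIso_map_inter_left_of_isZero R M _ _ (interior_compl_union_interior_range hi) k
    (isZero_singularHomology_of_contractibleSpace R M k.succ_ne_zero)
    (isZero_singularHomology_of_contractibleSpace R M hk) (isZero_singularHomology_range R M hi hk)

/-- For `m ≥ 1` and `X` path connected Hausdorff, `X ∖ {i 0}` is path connected (general position
off a point with a Euclidean neighbourhood of dimension `m + 1 ≥ 2`; tree theorem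
`isPathConnected_compl_singleton_of_isOpenEmbedding`). [folklore] -/
theorem pathConnectedSpace_compl_center [T2Space X] [PathConnectedSpace X] (hi : IsOpenEmbedding i)
    (hm : 1 ≤ m) : PathConnectedSpace ↥(({i 0}ᶜ : Set X)) := by
  rw [← isPathConnected_iff_pathConnectedSpace]
  refine FundamentalGroupoid.isPathConnected_compl_singleton_of_isOpenEmbedding hi ?_
  rw [finrank_euclideanSpace_fin]
  omega

/-- **The link of a Euclidean point of a contractible space is a homology sphere.** Let `X` be a
contractible Hausdorff space and `i : ℝᵐ⁺¹ → X` an open embedding, `m ≥ 1`. Then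
`y ↦ i y : Sᵐ → X ∖ {i 0}` induces isomorphisms `Hₖ(Sᵐ; M) ≅ Hₖ(X ∖ {i 0}; M)` for all `k`. This is
the sentence "the inclusion `Sⁿ → W` induces a homology isomorphism" of Kervaire–Milnor's proof of
their Lemma 2.3 (*Groups of homotopy spheres I* (1963), p. 506; there `W' ⊇ W = W' - Int Dⁿ⁺¹`, a
deformation retract of `W' ∖ {p}`), proved by Mayer–Vietoris for the cover
`X = (X ∖ {i 0}) ∪ i(ℝᵐ⁺¹)` in positive degrees (`isIso_singularHomology_map_inter_compl_center`,
`ℝᵐ⁺¹ ∖ {0} ≃ Sᵐ`) and by path connectedness of both spaces in degree `0` (Hatcher 2002, §2.2 and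
Prop. 2.7; `pathConnectedSpace_sphere` of `CollapseMap.lean`). [cite: KervaireMilnorAnnals1963, Lemma 2.3, proof (p. 506)] -/
theorem isIso_singularHomology_map_sphereToComplCenter [T2Space X] [ContractibleSpace X]
    (hi : IsOpenEmbedding i) (hm : 1 ≤ m) (k : ℕ) :
    IsIso (singularHomology.map R M (sphereToComplCenter hi.isEmbedding) k) := by
  rcases Nat.eq_zero_or_pos k with rfl | hk
  · haveI := pathConnectedSpace_compl_center hi hm
    haveI := pathConnectedSpace_sphere (n := m) (by omega)
    exact singularHomology.isIso_map_zero_of_pathConnectedSpace R M _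
  · haveI := isIso_singularHomology_map_inter_compl_center R M hi hk.ne'
    haveI := isIso_singularHomology_map_sphereToComplZero R M m k
    rw [sphereToComplCenter_eq, singularHomology.map_comp, singularHomology.map_comp,
      ← singularHomology.mapIso_hom]
    infer_instance

end Link

end Literature.AlgebraicTopology.SingularHomology

end
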